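import Summits.CriticalPhenomena.PercolationContinuityZ3.Theorems.PercNearOneGluingNoHeavyLowerTailAntiBandJ
import Summits.CriticalPhenomena.PercolationContinuityZ3.Theorems.PercNearOneGluingNoHeavyLowerTailThresholdRABThreePartition

/-!
# `NoHeavyLowerTail` (crux stmt-CriticalPhenomena-4575), lane prim-ineq-gen-4 (gen 19): THREE-PARTITION POSITIVITY FOR THE
# CO-DICTATOR THRESHOLD SLOT `Θ_{n−1} = {T : n − 1 ≤ |T|}` IN EVERY DIMENSION `n ≥ 3` (Theorem C of the gen-19 memo)

Support file (`--supports stmt-CriticalPhenomena-4575`; memo `run/shared/lean/prim/prim-ineq-gen-4/FINDING-FLAG-CERTIFICATES-g19.md`,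
Theorem C).  Pure proofs, no definitions, no `sorry`, standard axioms.

THEOREM (`ThreePartition.threePartN_coThreshold_nonneg`): for a finite type `ι` with `3 ≤ card ι` and up-sets `V, W ⊆ 𝒫(ι)`,
`0 ≤ threePartN {T | card ι − 1 ≤ T.ncard} V W`.  (`k = card ι` is the principal stratum, `k ≤ 3` and all large `n` are gen-17/18
theorems; this is the first threshold family proved in EVERY dimension from the small-`n` side.)

PROOF.  In the kernel form of `N(Θ_k,V,W)` (gen 17) with `k = n−1` only five counts survive: with `A₁` = common singletons, `Y` = common
co-singletons, `I = [univ ∈ V∩W]`, `X₁ = #{p : {p} ∈ V, {p}ᶜ ∈ W}`, `X₂ = #{p : {p}ᶜ ∈ V, {p} ∈ W}` one has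
`dee(V,Θ∩W) = X₁`, `dee(W,Θ∩V) = X₂`, `dee(Θ,V∩W) = A₁`, `top(Θ∩V∩W) = 2Y + I`, `tee(Θ,V,W) = 0`, so `N = 4Y + 2I − A₁ − X₁ − X₂`;
LEMMA J (`AntiBand.card_cross_outer_one_le`, gen 19) gives `X₁ + X₂ ≤ A₁ + Y + I`, and `2A₁ ≤ 3Y + I` (a common singleton `{p}` makes
the `n−1` co-singletons through `p` common).  Here the five counts are only BOUNDED in the needed direction (sub- and super-families), which
suffices.  The transport from the counting form to `threePartN` is gen-18's (`…ThresholdRABThreePartition`), packaged once and for all as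
`threePartN_threshold_nonneg_of_counting` (any `k`, any proof of the counting form).
-/

noncomputable section

open Finset
open scoped FinsetFamily Classical

namespace Summit.CriticalPhenomena.PercolationContinuityZ3.Theorems.AntiBand

variable {α : Type*} [DecidableEq α] [Fintype α]

/-- A common singleton `{p}` of two up-sets makes every co-singleton `{q}ᶜ`, `q ≠ p`, common; hence
`2·#(common singletons) ≤ 3·#(common co-singletons) + [univ common]` once `2 ≤ card α`. [this work] -/
theorem two_mul_card_common_singletons_le (W V : Finset (Finset α)) (hW : IsUpperSet (W : Set (Finset α)))
    (hV : IsUpperSet (V : Set (Finset α))) (hα : 2 ≤ Fintype.card α) :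
    2 * #(univ.filter fun i : α => ({i} : Finset α) ∈ W ∧ ({i} : Finset α) ∈ V)
      ≤ 3 * #(univ.filter fun i : α => ({i} : Finset α)ᶜ ∈ W ∧ ({i} : Finset α)ᶜ ∈ V)
        + (if (univ : Finset α) ∈ W ∩ V then 1 else 0) := by
  set P := univ.filter fun i : α => ({i} : Finset α) ∈ W ∧ ({i} : Finset α) ∈ V with hP
  set Y := univ.filter fun i : α => ({i} : Finset α)ᶜ ∈ W ∧ ({i} : Finset α)ᶜ ∈ V with hY
  by_cases hPe : P = ∅
  · rw [hPe, card_empty]; exact Nat.zero_le _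
  obtain ⟨p, hp⟩ := nonempty_iff_ne_empty.2 hPe
  have hp' : ({p} : Finset α) ∈ W ∧ ({p} : Finset α) ∈ V := by
    have := hp; simp only [P, mem_filter, mem_univ, true_and] at this; exact this
  have huniv : (univ : Finset α) ∈ W ∩ V :=
    mem_inter.2 ⟨univ_mem_of_mem hW hp'.1, univ_mem_of_mem hV hp'.2⟩
  rw [if_pos huniv]
  have hsub : (univ : Finset α).erase p ⊆ Y := by
    intro q hq
    rw [mem_erase] at hq
    simp only [Y, mem_filter, mem_univ, true_and]
    exact ⟨compl_singleton_mem_of_singleton_mem hW hp'.1 hq.1, compl_singleton_mem_of_singleton_mem hV hp'.2 hq.1⟩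
  have h1 : #((univ : Finset α).erase p) = Fintype.card α - 1 := by rw [card_erase_of_mem (mem_univ p), card_univ]
  have h2 := card_le_card hsub
  have h3 : #P ≤ Fintype.card α := by rw [← card_univ]; exact card_le_card (filter_subset _ _)
  omega

omit [DecidableEq α] in
/-- A nonempty finset disjoint from a finset of size `≥ card α − 1` forces that finset to be a co-singleton `{p}ᶜ` and itself to be `{p}`.
[folklore] -/
theorem eq_singleton_compl_of_disjoint [DecidableEq α] {a b : Finset α} (ha : a ≠ ∅) (hd : Disjoint a b)
    (hb : Fintype.card α - 1 ≤ #b) : ∃ p : α, a = {p} ∧ b = ({p} : Finset α)ᶜ := by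
  have hab : #a + #b ≤ Fintype.card α := by
    rw [← card_union_of_disjoint hd, ← card_univ]; exact card_le_card (subset_univ _)
  have ha1 : 0 < #a := by rw [card_pos]; exact nonempty_iff_ne_empty.2 ha
  have hbc : #(bᶜ) = 1 := by rw [card_compl]; omega
  obtain ⟨p, hp⟩ := card_eq_one.1 hbc
  refine ⟨p, ?_, ?_⟩
  · have hsub : a ⊆ bᶜ := by
      intro x hx
      rw [mem_compl]
      exact fun hxb => disjoint_left.1 hd hx hxb
    rw [hp] at hsub
    have hca : #a = 1 := by
      have := card_le_card hsub; rw [card_singleton] at this; omega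
    obtain ⟨x, hx⟩ := card_eq_one.1 hca
    rw [hx] at hsub ⊢
    have := mem_singleton.1 (hsub (mem_singleton_self x))
    rw [this]
  · rw [← hp, compl_compl]

/-- **Counting form of `N(Θ_{n−1},V,W) ≥ 0`** (same five pair-counts as gen-17/18's counting forms, `k = card α − 1`): for up-sets
`V, W` with `∅ ∉ V`, `∅ ∉ W` and `3 ≤ card α`,
`#{(v,w): k ≤ #w} + #{(v,w): k ≤ #v} + #{(u,s): k ≤ #s} ≤ 2·#{(u,s): k ≤ #u} + #{(v,w): k ≤ #(v∪w)ᶜ}`. [this work] -/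
theorem coThreshold_counting (V W : Finset (Finset α)) (hV : IsUpperSet (V : Set (Finset α)))
    (hW : IsUpperSet (W : Set (Finset α))) (hV0 : ∅ ∉ V) (hW0 : ∅ ∉ W) (hα : 3 ≤ Fintype.card α) :
    #((univ : Finset (Finset α × Finset α)).filter fun q =>
        (q.1 ∈ V ∧ q.2 ∈ W ∧ Disjoint q.1 q.2) ∧ Fintype.card α - 1 ≤ #q.2)
      + #((univ : Finset (Finset α × Finset α)).filter fun q =>
        (q.1 ∈ V ∧ q.2 ∈ W ∧ Disjoint q.1 q.2) ∧ Fintype.card α - 1 ≤ #q.1)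
      + #((univ : Finset (Finset α × Finset α)).filter fun q =>
        ((q.1 ∈ V ∧ q.1 ∈ W) ∧ Disjoint q.1 q.2) ∧ Fintype.card α - 1 ≤ #q.2)
    ≤ 2 * #((univ : Finset (Finset α × Finset α)).filter fun q =>
        ((q.1 ∈ V ∧ q.1 ∈ W) ∧ Disjoint q.1 q.2) ∧ Fintype.card α - 1 ≤ #q.1)
      + #((univ : Finset (Finset α × Finset α)).filter fun q =>
          (q.1 ∈ V ∧ q.2 ∈ W ∧ Disjoint q.1 q.2) ∧ Fintype.card α - 1 ≤ #(q.1 ∪ q.2)ᶜ) := by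
  have hα1 : 1 ≤ Fintype.card α := by omega
  -- the point sets
  set P1 := univ.filter fun i : α => ({i} : Finset α) ∈ V ∧ ({i} : Finset α)ᶜ ∈ W with hP1
  set P2 := univ.filter fun i : α => ({i} : Finset α)ᶜ ∈ V ∧ ({i} : Finset α) ∈ W with hP2
  set A1 := univ.filter fun i : α => ({i} : Finset α) ∈ V ∧ ({i} : Finset α) ∈ W with hA1
  set Y := univ.filter fun i : α => ({i} : Finset α)ᶜ ∈ V ∧ ({i} : Finset α)ᶜ ∈ W with hY
  -- (1) X1 ≤ #P1
  have hX1 : #((univ : Finset (Finset α × Finset α)).filter fun q =>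
        (q.1 ∈ V ∧ q.2 ∈ W ∧ Disjoint q.1 q.2) ∧ Fintype.card α - 1 ≤ #q.2) ≤ #P1 := by
    refine le_trans (card_le_card (fun q hq => ?_)) (card_image_le (s := P1) (f := fun p : α => (({p} : Finset α), ({p} : Finset α)ᶜ)))
    simp only [mem_filter, mem_univ, true_and] at hq
    obtain ⟨⟨hv, hw, hd⟩, hc⟩ := hq
    have hne : q.1 ≠ ∅ := fun h => hV0 (h ▸ hv)
    obtain ⟨p, h1, h2⟩ := eq_singleton_compl_of_disjoint hne hd hc
    rw [mem_image]
    refine ⟨p, ?_, ?_⟩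
    · simp only [P1, mem_filter, mem_univ, true_and]; exact ⟨h1 ▸ hv, h2 ▸ hw⟩
    · exact Prod.ext h1.symm h2.symm
  -- (2) X2 ≤ #P2
  have hX2 : #((univ : Finset (Finset α × Finset α)).filter fun q =>
        (q.1 ∈ V ∧ q.2 ∈ W ∧ Disjoint q.1 q.2) ∧ Fintype.card α - 1 ≤ #q.1) ≤ #P2 := by
    refine le_trans (card_le_card (fun q hq => ?_)) (card_image_le (s := P2) (f := fun p : α => ((({p} : Finset α)ᶜ), ({p} : Finset α))))
    simp only [mem_filter, mem_univ, true_and] at hq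
    obtain ⟨⟨hv, hw, hd⟩, hc⟩ := hq
    have hne : q.2 ≠ ∅ := fun h => hW0 (h ▸ hw)
    obtain ⟨p, h1, h2⟩ := eq_singleton_compl_of_disjoint hne hd.symm hc
    rw [mem_image]
    refine ⟨p, ?_, ?_⟩
    · simp only [P2, mem_filter, mem_univ, true_and]; exact ⟨h2 ▸ hv, h1 ▸ hw⟩
    · exact Prod.ext h2.symm h1.symm
  -- (3) X3 ≤ #A1
  have hX3 : #((univ : Finset (Finset α × Finset α)).filter fun q =>
        ((q.1 ∈ V ∧ q.1 ∈ W) ∧ Disjoint q.1 q.2) ∧ Fintype.card α - 1 ≤ #q.2) ≤ #A1 := by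
    refine le_trans (card_le_card (fun q hq => ?_)) (card_image_le (s := A1) (f := fun p : α => (({p} : Finset α), ({p} : Finset α)ᶜ)))
    simp only [mem_filter, mem_univ, true_and] at hq
    obtain ⟨⟨⟨hv, hw⟩, hd⟩, hc⟩ := hq
    have hne : q.1 ≠ ∅ := fun h => hV0 (h ▸ hv)
    obtain ⟨p, h1, h2⟩ := eq_singleton_compl_of_disjoint hne hd hc
    rw [mem_image]
    refine ⟨p, ?_, ?_⟩
    · simp only [A1, mem_filter, mem_univ, true_and]; exact ⟨h1 ▸ hv, h1 ▸ hw⟩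
    · exact Prod.ext h1.symm h2.symm
  -- (4) X4 ≥ 2·#Y + I : three disjoint sub-families
  set X4s := (univ : Finset (Finset α × Finset α)).filter fun q =>
        ((q.1 ∈ V ∧ q.1 ∈ W) ∧ Disjoint q.1 q.2) ∧ Fintype.card α - 1 ≤ #q.1 with hX4s
  have hcs : ∀ p : α, #(({p} : Finset α)ᶜ) = Fintype.card α - 1 := fun p => by rw [card_compl, card_singleton]
  have hinj : Function.Injective fun p : α => ({p} : Finset α)ᶜ := fun i j h => singleton_injective (compl_injective h)
  set fa : α → Finset α × Finset α := fun p => ((({p} : Finset α)ᶜ), (∅ : Finset α)) with hfa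
  set fb : α → Finset α × Finset α := fun p => ((({p} : Finset α)ᶜ), ({p} : Finset α)) with hfb
  have hfa_inj : Function.Injective fa := fun i j h => hinj (congrArg Prod.fst h)
  have hfb_inj : Function.Injective fb := fun i j h => hinj (congrArg Prod.fst h)
  have hSa : Y.image fa ⊆ X4s := by
    intro q hq
    rw [mem_image] at hq
    obtain ⟨p, hp, rfl⟩ := hq
    simp only [Y, mem_filter, mem_univ, true_and] at hp
    simp only [X4s, fa, mem_filter, mem_univ, true_and]
    exact ⟨⟨hp, disjoint_empty_right _⟩, (hcs p).ge⟩
  have hSb : Y.image fb ⊆ X4s := by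
    intro q hq
    rw [mem_image] at hq
    obtain ⟨p, hp, rfl⟩ := hq
    simp only [Y, mem_filter, mem_univ, true_and] at hp
    simp only [X4s, fb, mem_filter, mem_univ, true_and]
    refine ⟨⟨hp, ?_⟩, (hcs p).ge⟩
    exact disjoint_left.2 fun x hx hx2 => (mem_compl.1 hx) hx2
  have hdab : Disjoint (Y.image fa) (Y.image fb) := by
    rw [disjoint_left]
    intro q hqa hqb
    rw [mem_image] at hqa hqb
    obtain ⟨p, _, rfl⟩ := hqa
    obtain ⟨p', _, h⟩ := hqb
    have h2 := congrArg Prod.snd h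
    simp only [fa, fb] at h2
    exact (singleton_ne_empty p') h2
  have hcardab : #(Y.image fa ∪ Y.image fb) = 2 * #Y := by
    rw [card_union_of_disjoint hdab, card_image_of_injective _ hfa_inj, card_image_of_injective _ hfb_inj]; ring
  have hX4 : 2 * #Y + (if (univ : Finset α) ∈ V ∩ W then 1 else 0) ≤ #X4s := by
    by_cases hu : (univ : Finset α) ∈ V ∩ W
    · rw [if_pos hu]
      have hc : ((univ : Finset α), (∅ : Finset α)) ∈ X4s := by
        simp only [X4s, mem_filter, mem_univ, true_and]
        refine ⟨⟨mem_inter.1 hu, disjoint_empty_right _⟩, ?_⟩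
        rw [card_univ]; omega
      have hnot : ((univ : Finset α), (∅ : Finset α)) ∉ Y.image fa ∪ Y.image fb := by
        rw [mem_union, mem_image, mem_image, not_or]
        constructor
        · rintro ⟨p, _, h⟩
          have h1 := congrArg Prod.fst h
          simp only [fa] at h1
          have : p ∉ (({p} : Finset α)ᶜ) := by rw [mem_compl, not_not]; exact mem_singleton_self p
          rw [h1] at this; exact this (mem_univ p)
        · rintro ⟨p, _, h⟩
          have h1 := congrArg Prod.fst h
          simp only [fb] at h1
          have : p ∉ (({p} : Finset α)ᶜ) := by rw [mem_compl, not_not]; exact mem_singleton_self p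
          rw [h1] at this; exact this (mem_univ p)
      have hsub : insert ((univ : Finset α), (∅ : Finset α)) (Y.image fa ∪ Y.image fb) ⊆ X4s :=
        insert_subset hc (union_subset hSa hSb)
      have := card_le_card hsub
      rw [card_insert_of_notMem hnot, hcardab] at this
      omega
    · rw [if_neg hu, add_zero]
      have := card_le_card (union_subset hSa hSb)
      rw [hcardab] at this; exact this
  -- (5) Lemma J in point form: X-type cross counts ≤ A1 + Y + I
  have hJ := card_cross_outer_one_le W V hW hV hα
  rw [card_filter_card_eq_one, card_filter_card_eq_pred _ hα1, card_filter_card_eq_one,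
    card_filter_card_eq_pred _ hα1] at hJ
  have e1 : (univ.filter fun i : α => ({i} : Finset α) ∈ W ∩ Vᶜˢ) = P2 := by
    ext i; simp only [P2, mem_filter, mem_univ, true_and, mem_inter, mem_compls]; tauto
  have e2 : (univ.filter fun i : α => ({i} : Finset α)ᶜ ∈ W ∩ Vᶜˢ) = P1 := by
    ext i; simp only [P1, mem_filter, mem_univ, true_and, mem_inter, mem_compls, compl_compl]; tauto
  have e3 : (univ.filter fun i : α => ({i} : Finset α) ∈ W ∩ V) = A1 := by
    ext i; simp only [A1, mem_filter, mem_univ, true_and, mem_inter]; tauto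
  have e4 : (univ.filter fun i : α => ({i} : Finset α)ᶜ ∈ W ∩ V) = Y := by
    ext i; simp only [Y, mem_filter, mem_univ, true_and, mem_inter]; tauto
  have e5 : ((univ : Finset α) ∈ W ∩ V) ↔ ((univ : Finset α) ∈ V ∩ W) := by rw [inter_comm]
  rw [e1, e2, e3, e4] at hJ
  have hJ' : #P2 + #P1 ≤ #A1 + #Y + (if (univ : Finset α) ∈ V ∩ W then 1 else 0) := by
    by_cases hu : (univ : Finset α) ∈ V ∩ W
    · rw [if_pos hu]; rw [if_pos (e5.2 hu)] at hJ; exact hJ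
    · rw [if_neg hu]; rw [if_neg (fun h => hu (e5.1 h))] at hJ; exact hJ
  -- (6) the singleton lemma
  have hS := two_mul_card_common_singletons_le V W hV hW (by omega : 2 ≤ Fintype.card α)
  have e6 : (univ.filter fun i : α => ({i} : Finset α) ∈ V ∧ ({i} : Finset α) ∈ W) = A1 := rfl
  have e7 : (univ.filter fun i : α => ({i} : Finset α)ᶜ ∈ V ∧ ({i} : Finset α)ᶜ ∈ W) = Y := rfl
  rw [e6, e7] at hS
  have h5 : 0 ≤ #((univ : Finset (Finset α × Finset α)).filter fun q =>
          (q.1 ∈ V ∧ q.2 ∈ W ∧ Disjoint q.1 q.2) ∧ Fintype.card α - 1 ≤ #(q.1 ∪ q.2)ᶜ) := Nat.zero_le _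
  omega

end Summit.CriticalPhenomena.PercolationContinuityZ3.Theorems.AntiBand

namespace Summit.CriticalPhenomena.PercolationContinuityZ3.Theorems.ThreePartition

variable {ι : Type*} [Fintype ι]

/-- **Transport, packaged**: any proof of the five-count counting form for the threshold `k` (for all finset up-sets `V', W'` with
`∅ ∉ V', W'`) gives `0 ≤ threePartN {T | k ≤ T.ncard} V W` for all up-sets `V, W`.  The proof is gen-18's
`threePartN_threshold_nonneg` with the counting form as a hypothesis. [this work] -/
theorem threePartN_threshold_nonneg_of_counting [DecidableEq ι] (k : ℕ)
    (hcount : ∀ V' W' : Finset (Finset ι), IsUpperSet (V' : Set (Finset ι)) → IsUpperSet (W' : Set (Finset ι)) →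
      (∅ : Finset ι) ∉ V' → (∅ : Finset ι) ∉ W' →
      #((univ : Finset (Finset ι × Finset ι)).filter fun q => (q.1 ∈ V' ∧ q.2 ∈ W' ∧ Disjoint q.1 q.2) ∧ k ≤ #q.2)
        + #((univ : Finset (Finset ι × Finset ι)).filter fun q => (q.1 ∈ V' ∧ q.2 ∈ W' ∧ Disjoint q.1 q.2) ∧ k ≤ #q.1)
        + #((univ : Finset (Finset ι × Finset ι)).filter fun q => ((q.1 ∈ V' ∧ q.1 ∈ W') ∧ Disjoint q.1 q.2) ∧ k ≤ #q.2)
      ≤ 2 * #((univ : Finset (Finset ι × Finset ι)).filter fun q => ((q.1 ∈ V' ∧ q.1 ∈ W') ∧ Disjoint q.1 q.2) ∧ k ≤ #q.1)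
        + #((univ : Finset (Finset ι × Finset ι)).filter fun q =>
            (q.1 ∈ V' ∧ q.2 ∈ W' ∧ Disjoint q.1 q.2) ∧ k ≤ #(q.1 ∪ q.2)ᶜ))
    (V W : Set (Set ι)) (hV : IsUpperSet V) (hW : IsUpperSet W) :
    0 ≤ threePartN {T : Set ι | k ≤ T.ncard} V W := by
  by_cases hV0 : (∅ : Set ι) ∈ V
  · rw [eq_univ_of_empty_mem hV hV0, threePartN_swap12]
    exact threePartN_univ_nonneg (isUpperSet_threshold k) hW
  by_cases hW0 : (∅ : Set ι) ∈ W
  · rw [eq_univ_of_empty_mem hW hW0, threePartN_swap13]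
    exact threePartN_univ_nonneg hV (isUpperSet_threshold k)
  set V' : Finset (Finset ι) := univ.filter fun s => (s : Set ι) ∈ V with hV'
  set W' : Finset (Finset ι) := univ.filter fun s => (s : Set ι) ∈ W with hW'
  have hmV : ∀ s : Finset ι, s ∈ V' ↔ (s : Set ι) ∈ V := fun s => by
    rw [hV', mem_filter]; exact ⟨fun h => h.2, fun h => ⟨mem_univ _, h⟩⟩
  have hmW : ∀ s : Finset ι, s ∈ W' ↔ (s : Set ι) ∈ W := fun s => by
    rw [hW', mem_filter]; exact ⟨fun h => h.2, fun h => ⟨mem_univ _, h⟩⟩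
  have hV'up : IsUpperSet (V' : Set (Finset ι)) := by
    intro a b hab ha
    rw [mem_coe, hmV] at ha ⊢
    exact hV (coe_subset.2 hab) ha
  have hW'up : IsUpperSet (W' : Set (Finset ι)) := by
    intro a b hab ha
    rw [mem_coe, hmW] at ha ⊢
    exact hW (coe_subset.2 hab) ha
  have hV'0 : (∅ : Finset ι) ∉ V' := fun h => hV0 (by rw [hmV, coe_empty] at h; exact h)
  have hW'0 : (∅ : Finset ι) ∉ W' := fun h => hW0 (by rw [hmW, coe_empty] at h; exact h)
  have hc := hcount V' W' hV'up hW'up hV'0 hW'0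
  have hΘ : ∀ s : Finset ι, ((s : Set ι) ∈ {T : Set ι | k ≤ T.ncard}) ↔ k ≤ #s := fun s => by
    rw [Set.mem_setOf_eq, Set.ncard_coe_finset]
  have hΘc : ∀ a b : Finset ι, (((a : Set ι) ∪ (b : Set ι))ᶜ ∈ {T : Set ι | k ≤ T.ncard}) ↔ k ≤ #(a ∪ b)ᶜ :=
    fun a b => by rw [← coe_union, ← coe_compl, hΘ]
  have hmVc : ∀ a b : Finset ι, (((a : Set ι) ∪ (b : Set ι))ᶜ ∈ V) ↔ (a ∪ b)ᶜ ∈ V' :=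
    fun a b => by rw [← coe_union, ← coe_compl, hmV]
  have hmWc : ∀ a b : Finset ι, (((a : Set ι) ∪ (b : Set ι))ᶜ ∈ W) ↔ (a ∪ b)ᶜ ∈ W' :=
    fun a b => by rw [← coe_union, ← coe_compl, hmW]
  have e_top : top ({T : Set ι | k ≤ T.ncard} ∩ V ∩ W) =
      #((univ : Finset (Finset ι × Finset ι)).filter fun q => ((q.1 ∈ V' ∧ q.1 ∈ W') ∧ Disjoint q.1 q.2) ∧ k ≤ #q.1) := by
    unfold top; rw [tri_eq_card_finsetPairs]
    refine card_bij' (fun r _ => ((r.1 ∪ r.2)ᶜ, r.1)) (fun q _ => (q.2, (q.2 ∪ q.1)ᶜ)) (fun r hr => ?_) (fun q hq => ?_)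
      (fun r hr => ?_) (fun q hq => ?_)
    · simp only [mem_filter, mem_univ, true_and] at hr ⊢
      obtain ⟨hd, hm⟩ := hr
      rw [Set.mem_inter_iff, Set.mem_inter_iff, hΘc, hmVc, hmWc] at hm
      exact ⟨⟨⟨hm.1.2, hm.2⟩, disjoint_compl_union_left _ _⟩, hm.1.1⟩
    · simp only [mem_filter, mem_univ, true_and] at hq ⊢
      obtain ⟨⟨⟨hv, hw⟩, hd⟩, h2⟩ := hq
      refine ⟨(disjoint_compl_union_left _ _).symm, ?_⟩
      rw [coe_union_coe_compl_union hd.symm, Set.mem_inter_iff, Set.mem_inter_iff, hΘ, ← hmV, ← hmW]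
      exact ⟨⟨h2, hv⟩, hw⟩
    · simp only [mem_filter, mem_univ, true_and] at hr
      exact Prod.ext rfl (compl_union_compl_union hr.1)
    · simp only [mem_filter, mem_univ, true_and] at hq
      exact Prod.ext (compl_union_compl_union hq.1.2.symm) rfl
  have e_deeU : dee {T : Set ι | k ≤ T.ncard} (V ∩ W) =
      #((univ : Finset (Finset ι × Finset ι)).filter fun q => ((q.1 ∈ V' ∧ q.1 ∈ W') ∧ Disjoint q.1 q.2) ∧ k ≤ #q.2) := by
    unfold dee; rw [tri_eq_card_finsetPairs]
    refine card_bij' (fun r _ => ((r.1 ∪ r.2)ᶜ, r.1)) (fun q _ => (q.2, (q.2 ∪ q.1)ᶜ)) (fun r hr => ?_) (fun q hq => ?_)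
      (fun r hr => ?_) (fun q hq => ?_)
    · simp only [mem_filter, mem_univ, true_and] at hr ⊢
      obtain ⟨hd, h1, hm⟩ := hr
      rw [Set.mem_inter_iff, hmVc, hmWc] at hm
      rw [hΘ] at h1
      exact ⟨⟨⟨hm.1, hm.2⟩, disjoint_compl_union_left _ _⟩, h1⟩
    · simp only [mem_filter, mem_univ, true_and] at hq ⊢
      obtain ⟨⟨⟨hv, hw⟩, hd⟩, h2⟩ := hq
      refine ⟨(disjoint_compl_union_left _ _).symm, (hΘ _).2 h2, ?_⟩
      rw [coe_union_coe_compl_union hd.symm, Set.mem_inter_iff, ← hmV, ← hmW]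
      exact ⟨hv, hw⟩
    · simp only [mem_filter, mem_univ, true_and] at hr
      exact Prod.ext rfl (compl_union_compl_union hr.1)
    · simp only [mem_filter, mem_univ, true_and] at hq
      exact Prod.ext (compl_union_compl_union hq.1.2.symm) rfl
  have e_deeV : dee V ({T : Set ι | k ≤ T.ncard} ∩ W) =
      #((univ : Finset (Finset ι × Finset ι)).filter fun q => (q.1 ∈ V' ∧ q.2 ∈ W' ∧ Disjoint q.1 q.2) ∧ k ≤ #q.2) := by
    unfold dee; rw [tri_eq_card_finsetPairs]
    refine card_bij' (fun r _ => (r.1, (r.1 ∪ r.2)ᶜ)) (fun q _ => (q.1, (q.1 ∪ q.2)ᶜ)) (fun r hr => ?_) (fun q hq => ?_)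
      (fun r hr => ?_) (fun q hq => ?_)
    · simp only [mem_filter, mem_univ, true_and] at hr ⊢
      obtain ⟨hd, h1, hm⟩ := hr
      rw [Set.mem_inter_iff, hΘc, hmWc] at hm
      rw [← hmV] at h1
      exact ⟨⟨h1, hm.2, (disjoint_compl_union_left _ _).symm⟩, hm.1⟩
    · simp only [mem_filter, mem_univ, true_and] at hq ⊢
      obtain ⟨⟨hv, hw, hd⟩, h2⟩ := hq
      refine ⟨(disjoint_compl_union_left _ _).symm, (hmV _).1 hv, ?_⟩
      rw [coe_union_coe_compl_union hd, Set.mem_inter_iff, hΘ, ← hmW]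
      exact ⟨h2, hw⟩
    · simp only [mem_filter, mem_univ, true_and] at hr
      exact Prod.ext rfl (compl_union_compl_union hr.1)
    · simp only [mem_filter, mem_univ, true_and] at hq
      exact Prod.ext rfl (compl_union_compl_union hq.1.2.2)
  have e_deeW : dee W ({T : Set ι | k ≤ T.ncard} ∩ V) =
      #((univ : Finset (Finset ι × Finset ι)).filter fun q => (q.1 ∈ V' ∧ q.2 ∈ W' ∧ Disjoint q.1 q.2) ∧ k ≤ #q.1) := by
    unfold dee; rw [tri_eq_card_finsetPairs]
    refine card_bij' (fun r _ => ((r.1 ∪ r.2)ᶜ, r.1)) (fun q _ => (q.2, (q.2 ∪ q.1)ᶜ)) (fun r hr => ?_) (fun q hq => ?_)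
      (fun r hr => ?_) (fun q hq => ?_)
    · simp only [mem_filter, mem_univ, true_and] at hr ⊢
      obtain ⟨hd, h1, hm⟩ := hr
      rw [Set.mem_inter_iff, hΘc, hmVc] at hm
      rw [← hmW] at h1
      exact ⟨⟨hm.2, h1, disjoint_compl_union_left _ _⟩, hm.1⟩
    · simp only [mem_filter, mem_univ, true_and] at hq ⊢
      obtain ⟨⟨hv, hw, hd⟩, h2⟩ := hq
      refine ⟨(disjoint_compl_union_left _ _).symm, (hmW _).1 hw, ?_⟩
      rw [coe_union_coe_compl_union hd.symm, Set.mem_inter_iff, hΘ, ← hmV]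
      exact ⟨h2, hv⟩
    · simp only [mem_filter, mem_univ, true_and] at hr
      exact Prod.ext rfl (compl_union_compl_union hr.1)
    · simp only [mem_filter, mem_univ, true_and] at hq
      exact Prod.ext (compl_union_compl_union hq.1.2.2.symm) rfl
  have e_tee : tee {T : Set ι | k ≤ T.ncard} V W =
      #((univ : Finset (Finset ι × Finset ι)).filter fun q =>
        (q.1 ∈ V' ∧ q.2 ∈ W' ∧ Disjoint q.1 q.2) ∧ k ≤ #(q.1 ∪ q.2)ᶜ) := by
    unfold tee; rw [tri_eq_card_finsetPairs]
    refine card_bij' (fun r _ => (r.2, (r.1 ∪ r.2)ᶜ)) (fun q _ => ((q.1 ∪ q.2)ᶜ, q.1)) (fun r hr => ?_) (fun q hq => ?_)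
      (fun r hr => ?_) (fun q hq => ?_)
    · simp only [mem_filter, mem_univ, true_and] at hr ⊢
      obtain ⟨hd, h1, h2, h3⟩ := hr
      rw [hΘ] at h1
      rw [← hmV] at h2
      rw [hmWc] at h3
      refine ⟨⟨h2, h3, ?_⟩, ?_⟩
      · exact disjoint_left.2 fun x hx hxc => (mem_compl.1 hxc) (mem_union_right _ hx)
      · rw [union_comm r.1 r.2, compl_union_compl_union hd.symm]; exact h1
    · simp only [mem_filter, mem_univ, true_and] at hq ⊢
      obtain ⟨⟨hv, hw, hd⟩, h2⟩ := hq
      refine ⟨disjoint_compl_union_left _ _, (hΘ _).2 h2, (hmV _).1 hv, ?_⟩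
      rw [coe_compl_union_union_coe hd, ← hmW]; exact hw
    · simp only [mem_filter, mem_univ, true_and] at hr
      refine Prod.ext ?_ rfl
      show (r.2 ∪ (r.1 ∪ r.2)ᶜ)ᶜ = r.1
      rw [union_comm r.1 r.2, compl_union_compl_union hr.1.symm]
    · simp only [mem_filter, mem_univ, true_and] at hq
      refine Prod.ext rfl ?_
      show ((q.1 ∪ q.2)ᶜ ∪ q.1)ᶜ = q.2
      exact compl_compl_union_union hq.1.2.2
  unfold threePartN
  rw [e_top, e_tee, e_deeU, e_deeV, e_deeW]
  push_cast
  omega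

/-- **THEOREM C (gen 19): three-partition positivity with the co-dictator threshold slot `Θ_{n−1}` in every dimension `n ≥ 3`.**
For a finite type `ι` with `3 ≤ card ι` and all up-sets `V, W`: `0 ≤ threePartN {T | card ι − 1 ≤ T.ncard} V W`. [this work] -/
theorem threePartN_coThreshold_nonneg [DecidableEq ι] (hι : 3 ≤ Fintype.card ι) (V W : Set (Set ι))
    (hV : IsUpperSet V) (hW : IsUpperSet W) :
    0 ≤ threePartN {T : Set ι | Fintype.card ι - 1 ≤ T.ncard} V W :=
  threePartN_threshold_nonneg_of_counting (Fintype.card ι - 1)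
    (fun V' W' hV' hW' hV0 hW0 => AntiBand.coThreshold_counting V' W' hV' hW' hV0 hW0 hι) V W hV hW

end Summit.CriticalPhenomena.PercolationContinuityZ3.Theorems.ThreePartition
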